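import Summits.Ventures.Crystal3D.Theorems.StickyWulffConstantTextureBuildExposedEngine
import Summits.Ventures.Crystal3D.Theorems.StickyWulffConstantTextureBuildMassCover
import Summits.Ventures.Crystal3D.Theorems.StickyWulffConstantTextureBuildDesignated
import Summits.Ventures.Crystal3D.Theorems.StickyWulffConstantTextureBuildLedgerClip
import Summits.Ventures.Crystal3D.Theorems.StickyWulffConstantTextureBuildPiecePairs
import HarnessLib

/-!
# TB-energy blueprint, the EXPOSED/CONTACT engine, part 2: "FAR SIDE A.E. MATERIAL ⇒ NOTHING EXPOSED", and the CORE row of stub_LP1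
# (lane T, crux `TextureLiminfV5`, stmt-Ventures-23912; TB-D-3-g20 §engine E2/E3, §LP1 row (K))

HONEST FRAMING. Venture `Summits/Ventures/Crystal3D` (cell `crystal3d-full`), route `route-Ventures-StickyWulffConstant`, helper `--supports` the
law-v5 crux `TextureLiminfV5` (stmt-Ventures-23912).  Bookkeeping over the labelled cells of a texture input (standard axioms; no mesh constructed; F-C1 not moved).

WHAT.
* (E3) material lemmas off the null set `massNull` (…MassCover): `mem_pieceSet_of_gap`, `mem_pieceSet_of_box`, `mem_pieceSet_of_territory` (territory closure with
  the free-zone solidity guard), next to the landed `…of_core / …of_prism / …of_solid`; designated-set membership `mem_desSet_D/Q/B/P`.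
* (E2) `facetArea_exposed_eq_zero_of_far`: if at ONE generic facet point of a piece the far half-ball is material off `massNull`, the piece's whole exposed
  area along that facet datum is `0` (flip cell is a piece: `exists_labelled_flip_of_ae_subset` + `facetArea_exposed_eq_zero_of_flip`).
* ROW (K) of stub_LP1: `exposed_core_eq_zero` — for a CORE cell, the exposed part of every facet outside the designated regions of either orientation
  has area `0` (`hcollar₃` inside the territory, `hbdry` on its frontier).
-/

noncomputable section

open scoped BigOperators InnerProductSpace ENNReal
open MeasureTheory Set

namespace Summit.Ventures.Crystal3D.Cruxes.TextureLiminf.TexShadow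

open Summit.Ventures.Crystal3D Summit.Ventures.Crystal3D.Theorems

/-- H-polytopes are open. -/
theorem isOpen_polytopeH (H : Finset (E3 × ℝ)) : IsOpen (polytope H) := by
  unfold polytope
  exact isOpen_biInter_finset fun q _ => isOpen_lt (continuous_const.inner continuous_id) continuous_const

namespace Mesh₅

variable {C R₀ : ℝ} {N : ℕ} {x : Fin N → E3} {rc : RiseredCover C R₀ N x} {δ : ℝ} (μ : Mesh₅ rc δ)

/-- Designated territory facets are in `desSet`. -/
theorem mem_desSet_D {f : Fin rc.ng} {j : Fin (μ.nD f)} {p : E3 × ℝ} (hp : p ∈ μ.desD f j) : (μ.HD f j, p) ∈ μ.desSet := by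
  simp only [desSet, Finset.mem_union, Finset.mem_biUnion, Finset.mem_univ, true_and, Finset.mem_image]
  exact Or.inl (Or.inl (Or.inl ⟨f, j, p, hp, rfl⟩))

/-- Designated gap facets are in `desSet`. -/
theorem mem_desSet_Q {l : Fin μ.nQ} {p : E3 × ℝ} (hp : p ∈ μ.desQ l) : (μ.HQ l, p) ∈ μ.desSet := by
  simp only [desSet, Finset.mem_union, Finset.mem_biUnion, Finset.mem_univ, true_and, Finset.mem_image]
  exact Or.inl (Or.inl (Or.inr ⟨l, p, hp, rfl⟩))

/-- Designated box facets are in `desSet`. -/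
theorem mem_desSet_B {r : Fin rc.nr} {p : E3 × ℝ} (hp : p ∈ μ.desB r) : (μ.HB r, p) ∈ μ.desSet := by
  simp only [desSet, Finset.mem_union, Finset.mem_biUnion, Finset.mem_univ, true_and, Finset.mem_image]
  exact Or.inl (Or.inr ⟨r, p, hp, rfl⟩)

/-- Designated lateral prism facets are in `desSet`. -/
theorem mem_desSet_P {k : Fin rc.nk} {p : E3 × ℝ} (hp : p ∈ μ.latP k) : (μ.HP k, p) ∈ μ.desSet := by
  simp only [desSet, Finset.mem_union, Finset.mem_biUnion, Finset.mem_univ, true_and, Finset.mem_image]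
  exact Or.inr ⟨k, p, hp, rfl⟩

/-- the designated regions usable by a facet datum `q` (either orientation) -/
def desOf (q : E3 × ℝ) : Set E3 :=
  ⋃ d ∈ μ.desSet.filter (fun d => (d.2.1 = q.1 ∧ d.2.2 = q.2) ∨ (-d.2.1 = q.1 ∧ -d.2.2 = q.2)), facetOf d.1 d.2

end Mesh₅

namespace TexInput

variable {C R₀ : ℝ} {N : ℕ} {x : Fin N → E3} {rc : RiseredCover C R₀ N x} {δ : ℝ} {μ : Mesh₅ rc δ} (I : TexInput rc μ)

/-! ### (E3) material off the null set -/

/-- **Gap pieces are covered**: a point of the closure of a gap piece off the exceptional set lies in the pieces. -/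
theorem mem_pieceSet_of_gap (l : Fin μ.nQ) {z : E3} (hz : z ∈ closure (polytope (μ.HQ l))) (hzN : z ∉ I.massNull) : z ∈ I.pieceSet := by
  have hzP : z ∈ polytope (μ.HQ l) := I.mem_polytope_of_mem_closure (I.HQ_subset_𝓗 l) hz hzN
  have hG : μ.HQ l ∈ I.𝒢 := by
    simp only [𝒢, Finset.mem_union, Finset.mem_biUnion, Finset.mem_univ, true_and, Finset.mem_image]
    exact Or.inl (Or.inl (Or.inr ⟨l, rfl⟩))
  obtain ⟨j, hzj⟩ := I.exists_cell_of_mem hG hzP hzN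
  exact I.mem_pieceSet_of_isSome
    (I.isSome_lab_of_subset j (I.HQ_subset_𝓗 l) (Or.inr (Or.inr (Or.inl ⟨l, rfl⟩)))
      (refineCells_subset_of_mem _ _ _ _ _ _ _ j (I.HQ_subset_𝓗 l) hzj hzP)) hzj

/-- **Riser boxes are covered**: a point of the closure of a box off the exceptional set lies in the pieces. -/
theorem mem_pieceSet_of_box (r : Fin rc.nr) {z : E3} (hz : z ∈ closure (polytope (μ.HB r))) (hzN : z ∉ I.massNull) : z ∈ I.pieceSet := by
  have hzP : z ∈ polytope (μ.HB r) := I.mem_polytope_of_mem_closure (I.HB_subset_𝓗 r) hz hzN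
  have hG : μ.HB r ∈ I.𝒢 := by
    simp only [𝒢, Finset.mem_union, Finset.mem_biUnion, Finset.mem_univ, true_and, Finset.mem_image]
    exact Or.inl (Or.inr ⟨r, rfl⟩)
  obtain ⟨j, hzj⟩ := I.exists_cell_of_mem hG hzP hzN
  exact I.mem_pieceSet_of_isSome
    (I.isSome_lab_of_subset j (I.HB_subset_𝓗 r) (Or.inr (Or.inr (Or.inr ⟨r, rfl⟩)))
      (refineCells_subset_of_mem _ _ _ _ _ _ _ j (I.HB_subset_𝓗 r) hzj hzP)) hzj

/-- **Guarded territory closures are covered**: a point of `closure D_f` off the exceptional set, solid if in the free zone, lies in the pieces. -/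
theorem mem_pieceSet_of_territory (f : Fin rc.ng) {z : E3} (hz : z ∈ closure (⋃ j, polytope (μ.HD f j)))
    (hguard : z ∈ (rc.tent f).U → rc.SolidAt f z) (hzN : z ∉ I.massNull) : z ∈ I.pieceSet := by
  rw [closure_iUnion_of_finite (ι := Fin (μ.nD f)) (fun j => polytope (μ.HD f j)), mem_iUnion] at hz
  obtain ⟨jd, hzc⟩ := hz
  have hzD : z ∈ polytope (μ.HD f jd) := I.mem_polytope_of_mem_closure (I.HD_subset_𝓗 f jd) hzc hzN
  by_cases hzU : z ∈ (rc.tent f).U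
  · exact I.mem_pieceSet_of_solid f hzU (hguard hzU) hzN
  · have hzc : z ∈ closure (⋃ j, polytope (μ.HC f j)) := by
      by_contra h
      exact hzU (by rw [μ.hU f]; exact ⟨mem_iUnion.2 ⟨jd, hzD⟩, h⟩)
    exact I.mem_pieceSet_of_core f hzc hzN

/-! ### (E2) far side a.e. material ⇒ nothing exposed -/

/-- the exposed part of the facet of piece `i` carried by `q` -/
def exposed (i : Fin I.cells.M) (q : E3 × ℝ) : Set E3 :=
  (closure (polytope (I.cells.Hp i)) ∩ {y : E3 | ⟪q.1, y⟫_ℝ = q.2}) \ ⋃ i' ∈ Finset.univ.erase i, closure (polytope (I.cells.Hp i'))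

/-- a facet point is GENERIC if it lies on no hyperplane of the arrangement other than the facet's -/
def Generic (q : E3 × ℝ) (y : E3) : Prop := ∀ p ∈ I.𝓗, ¬ (p = q ∨ p = antip q) → ⟪p.1, y⟫_ℝ ≠ p.2

/-- **(E2) If at one generic facet point the far half-ball is material off the null set, the whole exposed area along the facet datum vanishes.** -/
theorem facetArea_exposed_eq_zero_of_far (i : Fin I.cells.M) {q : E3 × ℝ} (hq : q ∈ I.cells.Hp i) {y : E3} (hyq : ⟪q.1, y⟫_ℝ = q.2)
    (hy : y ∈ closure (polytope (I.cells.Hp i))) (hgen : I.Generic q y) {ρ : ℝ} (hρ : 0 < ρ)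
    (hfar : ∀ z ∈ Metric.ball y ρ, q.2 < ⟪q.1, z⟫_ℝ → z ∉ I.massNull → z ∈ I.pieceSet) :
    facetArea (I.exposed i q) q.1 = 0 := by
  classical
  have hae : volume ((Metric.ball y ρ ∩ {x : E3 | q.2 < ⟪q.1, x⟫_ℝ}) \ ⋃ i', polytope (I.cells.Hp i')) = 0 := by
    refine measure_mono_null (fun z hz => ?_) I.volume_massNull
    obtain ⟨⟨hzb, hzq⟩, hzp⟩ := hz
    by_contra hzN
    exact hzp (hfar z hzb hzq hzN)
  obtain ⟨i', hne, hflip⟩ := I.cells.exists_labelled_flip_of_ae_subset i hq hyq hy hgen hρ hae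
  exact facetArea_exposed_eq_zero_of_flip I.cells.Hp I.𝓗_unit (i₀ := i) rfl (I.cells.hbd_Hp i) hq hne hflip

/-- The non-generic part of a facet of a piece is null. -/
theorem facetArea_nonGeneric_eq_zero' (i : Fin I.cells.M) {q : E3 × ℝ} (hq : q ∈ I.cells.Hp i) :
    facetArea {y : E3 | y ∈ closure (polytope (I.cells.Hp i)) ∧ ⟪q.1, y⟫_ℝ = q.2 ∧ ¬ I.Generic q y} q.1 = 0 := by
  have h := facetArea_nonGenericH_eq_zero (𝓗 := I.𝓗) (T := I.cells.T (I.cells.idx i)) I.𝓗_unit (I.cells.hbd_Hp i) hq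
  have hEq : {y : E3 | y ∈ closure (polytope (I.cells.Hp i)) ∧ ⟪q.1, y⟫_ℝ = q.2 ∧ ¬ I.Generic q y} =
      {y : E3 | y ∈ closure (polytope (signedH I.𝓗 (I.cells.T (I.cells.idx i)))) ∧ ⟪q.1, y⟫_ℝ = q.2 ∧
        ∃ p ∈ I.𝓗, ¬ (p = q ∨ p = antip q) ∧ ⟪p.1, y⟫_ℝ = p.2} := by
    ext y
    simp only [Generic, mem_setOf_eq, not_forall, not_not, exists_prop]
    rfl
  rw [hEq]; exact h

/-- **The exposed-classification scheme**: if every GENERIC point of `exposed i q` outside a set `A` has a materially covered far half-ball, then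
`exposed i q ∖ A` is null. -/
theorem facetArea_exposed_diff_eq_zero (i : Fin I.cells.M) {q : E3 × ℝ} (hq : q ∈ I.cells.Hp i) (A : Set E3)
    (h : ∀ y ∈ I.exposed i q, y ∉ A → I.Generic q y →
      ∃ ρ : ℝ, 0 < ρ ∧ ∀ z ∈ Metric.ball y ρ, q.2 < ⟪q.1, z⟫_ℝ → z ∉ I.massNull → z ∈ I.pieceSet) :
    facetArea (I.exposed i q \ A) q.1 = 0 := by
  refine le_antisymm ?_ (facetArea_nonneg _ _)
  by_cases hex : ∃ y ∈ I.exposed i q, y ∉ A ∧ I.Generic q y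
  · obtain ⟨y, hyE, hyA, hgen⟩ := hex
    obtain ⟨ρ, hρ, hfar⟩ := h y hyE hyA hgen
    have h0 := I.facetArea_exposed_eq_zero_of_far i hq hyE.1.2 hyE.1.1 hgen hρ hfar
    rw [← h0]
    exact facetArea_mono_of_subset (I.cells.hbd_Hp i) (fun z hz => hz.1.1) sdiff_subset q.1
  · simp only [not_exists, not_and] at hex
    rw [← I.facetArea_nonGeneric_eq_zero' i hq]
    refine facetArea_mono_of_subset (I.cells.hbd_Hp i) (fun z hz => hz.1) (fun z hz => ?_) q.1
    simp only [mem_setOf_eq]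
    exact ⟨hz.1.1.1, hz.1.1.2, hex z hz.1 hz.2⟩

/-! ### ROW (K): core cells -/

/-- A designated territory facet through a generic facet point is usable by the facet datum. -/
theorem mem_desOf_of_desD {q : E3 × ℝ} {y : E3} (hgen : I.Generic q y) {f : Fin rc.ng} {j : Fin (μ.nD f)} {p : E3 × ℝ}
    (hp : p ∈ μ.desD f j) (hy : y ∈ facetOf (μ.HD f j) p) : y ∈ μ.desOf q := by
  have hp𝓗 : p ∈ I.𝓗 := I.HD_subset_𝓗 f j (μ.hdesD f j hp)
  have hpq : p = q ∨ p = antip q := by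
    by_contra h
    exact hgen p hp𝓗 h hy.2
  have hor : (p.1 = q.1 ∧ p.2 = q.2) ∨ (-p.1 = q.1 ∧ -p.2 = q.2) := by
    rcases hpq with rfl | rfl
    · exact Or.inl ⟨rfl, rfl⟩
    · exact Or.inr ⟨by simp [antip], by simp [antip]⟩
  simp only [Mesh₅.desOf, mem_iUnion, Finset.mem_filter, exists_prop]
  exact ⟨(μ.HD f j, p), ⟨μ.mem_desSet_D hp, hor⟩, hy⟩

/-- **ROW (K) of stub_LP1 — CORE cells expose nothing outside the designated regions.** -/
theorem exposed_core_eq_zero (i : Fin I.cells.M) {f : Fin rc.ng} {jc : Fin (μ.nC f)}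
    (hcore : polytope (I.cells.Hp i) ⊆ polytope (μ.HC f jc)) {q : E3 × ℝ} (hq : q ∈ I.cells.Hp i) :
    facetArea (I.exposed i q \ μ.desOf q) q.1 = 0 := by
  refine I.facetArea_exposed_diff_eq_zero i hq _ fun y hyE hyA hgen => ?_
  have hyCore : y ∈ closure (⋃ j, polytope (μ.HC f j)) :=
    closure_mono (hcore.trans (subset_iUnion (fun j => polytope (μ.HC f j)) jc)) hyE.1.1
  have hyD : y ∈ closure (⋃ j, polytope (μ.HD f j)) :=
    closure_mono (iUnion_subset fun j => μ.hCD f j) hyCore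
  by_cases hyin : y ∈ ⋃ j, polytope (μ.HD f j)
  · -- inside the territory: the collar is solid, the core is core
    obtain ⟨jd, hjd⟩ := mem_iUnion.1 hyin
    obtain ⟨ε, hε, hball⟩ := Metric.isOpen_iff.1 (isOpen_polytopeH (μ.HD f jd)) y hjd
    refine ⟨min ε 1, lt_min hε one_pos, fun z hz _ hzN => ?_⟩
    have hzD : z ∈ polytope (μ.HD f jd) := hball (Metric.ball_subset_ball (min_le_left _ _) hz)
    refine I.mem_pieceSet_of_territory f (subset_closure (mem_iUnion.2 ⟨jd, hzD⟩)) (fun hzU => ?_) hzN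
    refine μ.hcollar₃ f z hzU (lt_of_le_of_lt ?_ (show dist z y < 1 from lt_of_lt_of_le (Metric.mem_ball.1 hz) (min_le_right _ _)))
    have := Metric.infDist_le_infDist_add_dist (x := z) (y := y) (s := ⋃ j, polytope (μ.HC f j))
    rw [Metric.infDist_zero_of_mem_closure hyCore, zero_add] at this
    exact this
  · -- on the frontier: the boundary clause
    have hyfr : y ∈ frontier (⋃ j, polytope (μ.HD f j)) := by
      rw [(isOpen_iUnion fun j => isOpen_polytopeH (μ.HD f j)).frontier_eq]
      exact ⟨hyD, hyin⟩
    rcases μ.hbdry f y hyfr with ⟨-, hnc⟩ | ⟨j, p, hp, hyp⟩ | ⟨r, hr, hsol, hball⟩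
    · exact absurd hyCore hnc
    · exact absurd (I.mem_desOf_of_desD hgen hp hyp) hyA
    · refine ⟨r, hr, fun z hz _ hzN => ?_⟩
      rcases hball hz with hzD | ((((hB | hC) | hD) | hE) | hF)
      · exact I.mem_pieceSet_of_territory f hzD (fun hzU => hsol z hz hzU) hzN
      · obtain ⟨k, -, hzk⟩ := mem_iUnion₂.1 hB
        exact I.mem_pieceSet_of_prism k hzk.1 hzN
      · obtain ⟨k, -, hzk⟩ := mem_iUnion₂.1 hC
        exact I.mem_pieceSet_of_prism k hzk.1 hzN
      · obtain ⟨l, -, hzl⟩ := mem_iUnion₂.1 hD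
        exact I.mem_pieceSet_of_gap l hzl hzN
      · obtain ⟨r', -, hzr⟩ := mem_iUnion₂.1 hE
        exact I.mem_pieceSet_of_box r' hzr hzN
      · obtain ⟨g, -, hzg⟩ := mem_iUnion₂.1 hF
        exact I.mem_pieceSet_of_territory g hzg.1 hzg.2.1 hzN

end TexInput

end Summit.Ventures.Crystal3D.Cruxes.TextureLiminf.TexShadow

end
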